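import Summits.QuantumFields.YangMills.Theorems.UnitScaleTiltProp7BondAvgIterOneStrokeBridge
import Summits.QuantumFields.YangMills.Theorems.UnitScaleTiltProp8LinAvgFluxExact
import Summits.QuantumFields.YangMills.Theorems.UnitScaleTiltProp7LinAvgOnto
import Summits.QuantumFields.YangMills.Theorems.UnitScaleTiltProp8ChartDeriv
import HarnessLib

/-!
# `AlphaInputsT3ACv3LinAvgIterFluxRigid` — THE ITERATED LINEARISED (0.4) AVERAGE IS FLUX-RIGID: around a coarse plaquette of `T^{(s)}` the
# `s`-fold composition `Q^{(s)} = Q₁ ∘ ⋯ ∘ Q₁` of the linearised (0.4) average has circulation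
# `Σ_{c∈∂p′} ±(Q^{(s)}Y)(c) = L^s · L^{−s(d+1)} · Σ_{x ∈ B^s(y)} Σ_{a,b < L^s} Y(∂□₁(x + a e_μ + b e_ν))`
# — print's RIGID sum of [Balaban1985UV3] (69) «`Σ_{x∈B^j(x₀)} L^{−3j} Σ_{p⊂(p′)_x}`» — cell `ym3-torus`, width seat 19936-w6 (g2); (α)-seam LOCATE memo
# `ym-ust-19936-w6/LOCATE-alpha-seam-w6-g2.md` §2 piece (i)

WHY.  The symmetric∕comb seam of RULING g26-№8 (1)(α) (the displayed row `AlphaInputsT3AC.Large67CombOfRecT3` of `…RecordSelXsChi`) needs, on every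
branch, the TWO-SIDED first order of the symmetric `j`-fold average `(blockAvg ℰp)^j` at a coarse plaquette in the rigid shape that
`B10Eq70Squaring.ineq70_d3`'s `blockSum` reads ((69)_sym, memo §2).  The `k`-uniform second-order remainder is the tree's
`EMLIterUniform.norm_iter_sub_one_sub_iterLin_le_uniform`, stated for ANY family `Q` with `Q 0 = id`, `Q (s+1) Y c = linAvg (Q s Y) c`; THIS FILE supplies
the first-order term of such a family AROUND A PLAQUETTE in closed form.  Mechanism: `Q₁ = L·Q − dλ̄` (`linAvg_eq_bondAvg_sub_grad_combMean`) and `Q₁`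
maps gradients to coarse gradients (`linAvg_grad`), so `Q^{(s)} = L^s·Q^s + d(·)` (§2); gradients have no circulation (§1); and the straight average
`Q^s = bondAvgIter s` is the one-stroke block∕segment mean (`Prop7FlatCoercivity.bondAvgIter_eq_lineBlockAvg`, [Balaban1984PropagatorsI] (1.18)), whose
circulation is the block mean of the `L^s × L^s` rectangle circulations (fibre translation `sum_fibre_runSite` + the abelian Stokes theorem
`LinAvgFluxExact.rect_stokes`) (§3).  §4 assembles; §5 reads the block sum on the offset parametrisation `B^s(y) ≃ {0,…,L^s−1}^d`.

WHAT (def-free; generic torus `Setup.Params`, values `Matrix n n ℂ` for `Q^{(s)}`, any real vector space for `Q^s`): §1 `curl_coarseGrad_eq_zero`; §2 ★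
`exists_iterLinAvg_eq_smul_bondAvgIter_add_grad`; §3 ★ `curl_bondAvgIter_eq_rigidFlux`; §4 ★★ `curl_iterLinAvg_eq_rigidFlux`; §5 `curl_iterLinAvg_eq_rigidFlux_offsets`.
HONEST FRAMING.  Lattice bookkeeping (abelian, first order); no estimate of Bałaban's is asserted; nothing here touches the class of record or the registry (J r4).
Count-neutral helper toward R3 2′∕2′χ (`stub_laneRecordsV3Chi`, item 19936 — NOT proved here); YM₃ on T³ = rung R3 (finite-torus SU(2)), not T⁴, not the
continuum limit, not the Clay problem; no mass gap is claimed.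

References: T. Bałaban, Commun. Math. Phys. 95 (1984) 17–40 [Balaban1984PropagatorsI] ((1.11) p.19, (1.13) p.19, (1.18) p.20); CMP 98 (1985) 17–51 [Balaban1985Averaging]
((11) p.18, (42)–(43) p.24, (124)–(125) p.36); CMP 102 (1985) 255–275 [Balaban1985UV3] ((69) p.273).
-/

set_option autoImplicit false

noncomputable section

open scoped BigOperators

namespace Summit.QuantumFields.YangMills.Theorems.LinAvgIterFluxRigid

open Finset
open Literature.MathematicalPhysics.QuantumFieldTheory.Balaban1983to89
open T4Continuum BlockAveraging BlockAveragingEMLLinearised LatticeFieldCalculus B1RG242Torus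
open BlockAveragingEMLProp2 (shift_shift_comm)
open Summit.QuantumFields.YangMills.Theorems.Prop7FlatCoercivity (sum_fibre_runSite sum_fibre_eq_sum_offsets bondAvgIter_eq_lineBlockAvg
  sitesPerDir_zero_eq_pow_mul segSum_eq_sum_iterate_shift)
open Summit.QuantumFields.YangMills.Theorems.LinAvgFluxExact (rect_stokes)
open Summit.QuantumFields.YangMills.Theorems.Prop7LinAvgOnto (linAvg_add)
open Summit.QuantumFields.YangMills.Theorems.Prop8Chart (linAvg_const_smul)

variable {P : Params}

/-! ## §1 Gradients have no circulation -/

/-- A coarse gradient `c ↦ φ(c₊) − φ(c₋)` has zero circulation around every plaquette `(y; μ, ν)`. [folklore] -/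
theorem curl_coarseGrad_eq_zero {j : ℕ} {V : Type*} [AddCommGroup V] (φ : Site P j → V) (y : Site P j) (μ ν : Fin P.d) :
    (φ (y.shift μ) - φ y) + (φ ((y.shift μ).shift ν) - φ (y.shift μ)) - (φ ((y.shift ν).shift μ) - φ (y.shift ν)) - (φ (y.shift ν) - φ y) = 0 := by
  rw [shift_shift_comm y μ ν]
  abel

/-! ## §2 `Q^{(s)} = L^s·Q^s` modulo a coarse gradient -/

section Decomposition

variable {n : Type*}

/-- **★ THE ITERATED LINEARISED (0.4) AVERAGE IS `L^s` TIMES THE ITERATED STRAIGHT AVERAGE PLUS A COARSE GRADIENT**: for every family `Q` with `Q 0 = id`,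
`Q (s+1) Y c = linAvg (Q s Y) c` there is, for each `s`, a site function `φ` on `T^{(s)}` with `(Q^{(s)}Y)(c) = L^s·(Q^sY)(c) + φ(c₊) − φ(c₋)` for every bond `c`
(`Q^s = bondAvgIter s`; one step: `Q₁ = L·Q − dλ̄`, `linAvg_eq_bondAvg_sub_grad_combMean`, and `Q₁(dφ) = d(φ ∘ emb)`, `linAvg_grad`).
[cite: Balaban1985Averaging, (124)–(125) p.36, (11) p.18; Balaban1984PropagatorsI, (1.13) p.19] -/
theorem exists_iterLinAvg_eq_smul_bondAvgIter_add_grad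
    (Q : (i : ℕ) → (PBond P 0 → Matrix n n ℂ) → PBond P i → Matrix n n ℂ)
    (hQ0 : ∀ Y, Q 0 Y = Y) (hQs : ∀ (i : ℕ) (Y : PBond P 0 → Matrix n n ℂ) (c : PBond P (i + 1)), Q (i + 1) Y c = linAvg (Q i Y) c)
    (Y : PBond P 0 → Matrix n n ℂ) :
    ∀ s : ℕ, ∃ φ : Site P s → Matrix n n ℂ, ∀ c : PBond P s,
      Q s Y c = ((P.L : ℕ) : ℂ) ^ s • bondAvgIter s Y c + (φ c.tgt - φ c.src)
  | 0 => ⟨fun _ => 0, fun c => by rw [hQ0]; simp [bondAvgIter]⟩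
  | s + 1 => by
    obtain ⟨φ, hφ⟩ := exists_iterLinAvg_eq_smul_bondAvgIter_add_grad Q hQ0 hQs Y s
    refine ⟨fun y => φ (emb y) - ((P.L : ℕ) : ℂ) ^ s • combMean (bondAvgIter s Y) y, fun c => ?_⟩
    have hfun : Q s Y = fun b => ((P.L : ℕ) : ℂ) ^ s • bondAvgIter s Y b + (φ b.tgt - φ b.src) := funext hφ
    rw [hQs, hfun, linAvg_add, linAvg_const_smul, linAvg_grad, linAvg_eq_bondAvg_sub_grad_combMean]
    show ((P.L : ℕ) : ℂ) ^ s • (((P.L : ℕ) : ℂ) • bondAvg (bondAvgIter s Y) c - (combMean (bondAvgIter s Y) c.tgt - combMean (bondAvgIter s Y) c.src)) +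
        (φ (emb c.tgt) - φ (emb c.src)) =
      ((P.L : ℕ) : ℂ) ^ (s + 1) • bondAvg (bondAvgIter s Y) c +
        ((φ (emb c.tgt) - ((P.L : ℕ) : ℂ) ^ s • combMean (bondAvgIter s Y) c.tgt) -
          (φ (emb c.src) - ((P.L : ℕ) : ℂ) ^ s • combMean (bondAvgIter s Y) c.src))
    rw [smul_sub, smul_smul, ← pow_succ, smul_sub]
    abel

end Decomposition

/-! ## §3 The circulation of the iterated straight average is the block mean of the `L^s × L^s` rectangle circulations -/

section Straight

variable {V : Type*} [AddCommGroup V] [Module ℝ V]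

/-- **★ THE CIRCULATION OF `Q^s` AROUND A COARSE PLAQUETTE IS RIGID**: for every bond field `X` on the finest torus and every `(y; μ, ν)` of `T^{(s)}` (`s` in the standing range),
`Σ_{c∈∂p′} ±(Q^sX)(c) = L^{−s(d+1)}·Σ_{x∈B^s(y)} Σ_{a,b<L^s} X(∂□₁(x + a e_μ + b e_ν))` — the blocks over `y + e_μ`, `y + e_ν` are the translates of `B^s(y)` by `L^s`
(`sum_fibre_runSite`), and the four long segments at `x` close up to the `L^s × L^s` rectangle (`rect_stokes`). [cite: Balaban1984PropagatorsI, (1.18) p.20; Balaban1985UV3, (69) p.273] -/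
theorem curl_bondAvgIter_eq_rigidFlux {s : ℕ} (hs : s ≤ P.m + P.K) (X : VecField P 0 V) (y : Site P s) (μ ν : Fin P.d) :
    bondAvgIter s X ⟨y, μ⟩ + bondAvgIter s X ⟨y.shift μ, ν⟩ - bondAvgIter s X ⟨y.shift ν, μ⟩ - bondAvgIter s X ⟨y, ν⟩ =
      ((((P.L : ℝ) ^ s) ^ P.d * (P.L : ℝ) ^ s)⁻¹) •
        ∑ x ∈ univ.filter (fun x : Site P 0 => Site.proj s s x = y), ∑ a ∈ range (P.L ^ s), ∑ b ∈ range (P.L ^ s),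
          (X ⟨runSite (runSite x μ a) ν b, μ⟩ + X ⟨runSite (runSite (runSite x μ a) ν b) μ 1, ν⟩
            - X ⟨runSite (runSite (runSite x μ a) ν b) ν 1, μ⟩ - X ⟨runSite (runSite x μ a) ν b, ν⟩) := by
  have h0 : P.sitesPerDir 0 = P.L ^ s * P.sitesPerDir s := sitesPerDir_zero_eq_pow_mul hs
  have hshift : ∀ κ : Fin P.d, y.shift κ = runSite y κ 1 := fun κ => by
    rw [show (1 : ℕ) = 0 + 1 from rfl, runSite_succ, runSite_zero]
  rw [bondAvgIter_eq_lineBlockAvg hs X ⟨y, μ⟩, bondAvgIter_eq_lineBlockAvg hs X ⟨y.shift μ, ν⟩,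
    bondAvgIter_eq_lineBlockAvg hs X ⟨y.shift ν, μ⟩, bondAvgIter_eq_lineBlockAvg hs X ⟨y, ν⟩]
  simp only [← segSum_eq_sum_iterate_shift]
  -- the four blocks: `B^s(y + e_κ) = B^s(y) + L^s e_κ`
  rw [hshift μ, hshift ν, sum_fibre_runSite h0, sum_fibre_runSite h0, one_mul]
  rw [← smul_add, ← smul_sub, ← smul_sub, ← Finset.sum_add_distrib, ← Finset.sum_sub_distrib, ← Finset.sum_sub_distrib]
  congr 1
  refine Finset.sum_congr rfl fun x _ => ?_
  exact rect_stokes X x μ ν (P.L ^ s) (P.L ^ s)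

end Straight

/-! ## §4 The circulation of the iterated linearised (0.4) average -/

section Main

variable {n : Type*}

/-- **★★ THE ITERATED LINEARISED (0.4) AVERAGE IS FLUX-RIGID**: for every family `Q` with `Q 0 = id`, `Q (s+1) Y c = linAvg (Q s Y) c` (the hypotheses of
`EMLIterUniform.norm_iter_sub_one_sub_iterLin_le_uniform`), every fine bond field `Y` and every `(y; μ, ν)` of `T^{(s)}` (`s` in the standing range):
`Σ_{c∈∂p′} ±(Q^{(s)}Y)(c) = L^s · L^{−s(d+1)} · Σ_{x∈B^s(y)} Σ_{a,b<L^s} Y(∂□₁(x + a e_μ + b e_ν))` — print's rigid sum of (69) with weight `L^{−sd}`, the SAME first-order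
term as the comb average's ([Balaban1985Averaging] (42)–(43)). [cite: Balaban1985UV3, (69) p.273; Balaban1985Averaging, (124)–(125) p.36, (42)–(43) p.24] -/
theorem curl_iterLinAvg_eq_rigidFlux
    (Q : (i : ℕ) → (PBond P 0 → Matrix n n ℂ) → PBond P i → Matrix n n ℂ)
    (hQ0 : ∀ Y, Q 0 Y = Y) (hQs : ∀ (i : ℕ) (Y : PBond P 0 → Matrix n n ℂ) (c : PBond P (i + 1)), Q (i + 1) Y c = linAvg (Q i Y) c)
    {s : ℕ} (hs : s ≤ P.m + P.K) (Y : PBond P 0 → Matrix n n ℂ) (y : Site P s) (μ ν : Fin P.d) :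
    Q s Y ⟨y, μ⟩ + Q s Y ⟨y.shift μ, ν⟩ - Q s Y ⟨y.shift ν, μ⟩ - Q s Y ⟨y, ν⟩ =
      ((P.L : ℕ) : ℂ) ^ s • (((((P.L : ℝ) ^ s) ^ P.d * (P.L : ℝ) ^ s)⁻¹) •
        ∑ x ∈ univ.filter (fun x : Site P 0 => Site.proj s s x = y), ∑ a ∈ range (P.L ^ s), ∑ b ∈ range (P.L ^ s),
          (Y ⟨runSite (runSite x μ a) ν b, μ⟩ + Y ⟨runSite (runSite (runSite x μ a) ν b) μ 1, ν⟩
            - Y ⟨runSite (runSite (runSite x μ a) ν b) ν 1, μ⟩ - Y ⟨runSite (runSite x μ a) ν b, ν⟩)) := by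
  obtain ⟨φ, hφ⟩ := exists_iterLinAvg_eq_smul_bondAvgIter_add_grad Q hQ0 hQs Y s
  rw [hφ, hφ, hφ, hφ, ← curl_bondAvgIter_eq_rigidFlux hs Y y μ ν]
  have hg := curl_coarseGrad_eq_zero φ y μ ν
  simp only [PBond.tgt] at hg ⊢
  rw [smul_sub, smul_sub, smul_add]
  -- the gradient terms cancel
  have key : ∀ (A B C D gA gB gC gD : Matrix n n ℂ), gA + gB - gC - gD = 0 →
      (A + gA) + (B + gB) - (C + gC) - (D + gD) = A + B - C - D := by
    intro A B C D gA gB gC gD h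
    have : (A + gA) + (B + gB) - (C + gC) - (D + gD) = (A + B - C - D) + (gA + gB - gC - gD) := by abel
    rw [this, h, add_zero]
  exact key _ _ _ _ _ _ _ _ hg

/-! ## §5 The block sum on the offset parametrisation -/

/-- The same with `B^s(y)` parametrised by the offsets `r ∈ {0,…,L^s−1}^d` (`x = L^s·y + r`, `Site.fibreSite`): the index set of print's (69)∕`B10Eq70Squaring.blockSum`.
[cite: Balaban1985UV3, (69) p.273; Balaban1984PropagatorsI, (1.18) p.20] -/
theorem curl_iterLinAvg_eq_rigidFlux_offsets
    (Q : (i : ℕ) → (PBond P 0 → Matrix n n ℂ) → PBond P i → Matrix n n ℂ)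
    (hQ0 : ∀ Y, Q 0 Y = Y) (hQs : ∀ (i : ℕ) (Y : PBond P 0 → Matrix n n ℂ) (c : PBond P (i + 1)), Q (i + 1) Y c = linAvg (Q i Y) c)
    {s : ℕ} (hs : s ≤ P.m + P.K) (Y : PBond P 0 → Matrix n n ℂ) (y : Site P s) (μ ν : Fin P.d) :
    Q s Y ⟨y, μ⟩ + Q s Y ⟨y.shift μ, ν⟩ - Q s Y ⟨y.shift ν, μ⟩ - Q s Y ⟨y, ν⟩ =
      ((P.L : ℕ) : ℂ) ^ s • (((((P.L : ℝ) ^ s) ^ P.d * (P.L : ℝ) ^ s)⁻¹) •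
        ∑ r : Fin P.d → Fin (P.L ^ s), ∑ a ∈ range (P.L ^ s), ∑ b ∈ range (P.L ^ s),
          (Y ⟨runSite (runSite (Site.fibreSite 0 s y r) μ a) ν b, μ⟩ + Y ⟨runSite (runSite (runSite (Site.fibreSite 0 s y r) μ a) ν b) μ 1, ν⟩
            - Y ⟨runSite (runSite (runSite (Site.fibreSite 0 s y r) μ a) ν b) ν 1, μ⟩ - Y ⟨runSite (runSite (Site.fibreSite 0 s y r) μ a) ν b, ν⟩)) := by
  rw [curl_iterLinAvg_eq_rigidFlux Q hQ0 hQs hs Y y μ ν, sum_fibre_eq_sum_offsets (sitesPerDir_zero_eq_pow_mul hs)]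

end Main

end Summit.QuantumFields.YangMills.Theorems.LinAvgIterFluxRigid

end
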